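import Summits.AtomisticToContinuum.BoseEinsteinCondensation.Theorems.BECConjugateDominationHardCoreExtensionResidueSimplicity
import Summits.AtomisticToContinuum.BoseEinsteinCondensation.Theorems.PeriodicIRBound.Negative.AEClass
import Literature.MathematicalPhysics.QuantumManyBody.PeriodicConfigFourier
import HarnessLib

/-!
# The exotic residue sees only the a.e.-class of the potential
# (line `third-law-current-floor`, crux `BECConjugateDomination.HardCoreExtension`, stmt-AtomisticToContinuum-11786 — lead c5)

The fixed-volume objects of the line — the periodic energy, `E₀^per`, the Ky Fan level `kyFanTwo`, the maximal form and
its ground-state class `maxFormGroundStates` — see the pair profile `v` only through the a.e.-class of `x ↦ v(|x|)` on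
`ℝ³` (pair differences are quasi-measure-preserving on configuration space, `PeriodicIRBound.Negative.ae_pairDiff`;
the torus transport `fromUnitTorusN` pushes Haar measure to normalised Lebesgue measure on the cell,
`map_fromUnitTorusN`). Consequently the (β') input of the transfer (a Ky Fan gap of the truncations uniform in the level)
and the dilute simplicity statements are INVARIANT under a.e.-modification of the profile, and the exotic residue X of
`…ResidueSimplicity.lean` (registered stub `stub_diluteMaxFormSimple_exotic`) can be replaced by its ESSENTIAL form:

* **X_ess** — dilute eventual simplicity is asked only for admissible non-integrable `v` such that NO admissible profile
  a.e.-equal to `v` (as `x ↦ v(|x|)` on `ℝ³`) is bounded, locally bounded on `(0,∞)`, or of the hard-core class. Every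
  such `v` carries an essential singularity off the origin which is not an essential hard core from `0` (hard or
  singular shells, Cantor walls); `⊤` on a null set, a hard core decorated by null walls, etc. are no longer in the class.

Theorems: `ae_comp_fromUnitTorusN_of_ae` (transport of a.e. statements to the torus), `maxFormPot_congr_ae`,
`maxForm_congr_ae`, `maxFormGroundStates_congr_ae`, `kyFanTwo_congr_ae`, `uniformTruncationKyFanGap_congr_ae`,
`diluteMaxFormSimple_congr_ae`; `essExotic_of_exotic` (X ⇒ X_ess: the essential residue is WEAKER); and the (β') input
for every admissible non-integrable `v` modulo G + X_ess: `uniformTruncationKyFanGap_of_lemmaG_of_essExotic`.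

References: M. Reed, B. Simon, *Methods of Modern Mathematical Physics IV* (1978), §XIII.12; B. Simon, J. Operator Theory 1
(1979) 37, Thm. 2.1 (maximal forms); E. H. Lieb, R. Seiringer, J. P. Solovej, J. Yngvason (2005), Ch. 2 (2.1).
-/

noncomputable section

namespace Summit.AtomisticToContinuum.BoseEinsteinCondensation.Cruxes.HardCoreExtension.ThirdLawCurrentFloorAlt

open MeasureTheory Filter UnitAddTorus
open scoped ENNReal NNReal BigOperators Topology InnerProductSpace ComplexConjugate
open Literature.MathematicalPhysics.QuantumManyBody.BoseGas
open Literature.Analysis.FunctionSpaces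
open Summit.AtomisticToContinuum.BoseEinsteinCondensation.Theorems.PeriodicIRBound.Negative
  (periodicInteraction_congr_ae periodicEnergy_congr_ae periodicGroundStateEnergy_congr_ae)

-- The measure on `ℝ/ℤ` is the Haar PROBABILITY measure, as in `PeriodicFormDomain.lean` and in every landed file of the line.
attribute [local instance] Literature.MathematicalPhysics.QuantumManyBody.BoseGas.formDomain_measureSpace
  Literature.MathematicalPhysics.QuantumManyBody.BoseGas.formDomain_isProbabilityMeasure
  Literature.MathematicalPhysics.QuantumManyBody.BoseGas.formDomain_isProbabilityMeasure_pi

variable {N : ℕ} {L : ℝ}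

/-! ## Transport of a.e. statements from configuration space to the torus -/

/-- **A property holding a.e. on configuration space holds a.e. on the torus after `fromUnitTorusN L`** (`0 < L`):
the image of Haar measure is `L^{-3N} dX|_{[0,L)^{3N}} ≪ dX` (`map_fromUnitTorusN`). [folklore] -/
theorem ae_comp_fromUnitTorusN_of_ae (hL : 0 < L) {p : Config N → Prop} (h : ∀ᵐ X : Config N, p X) :
    ∀ᵐ t ∂(volume : Measure (UnitAddTorus (Fin N × Fin 3))), p (fromUnitTorusN L t) := by
  have h1 : ∀ᵐ X ∂(Measure.map (fromUnitTorusN (N := N) L) volume), p X := by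
    rw [map_fromUnitTorusN hL]
    exact Measure.ae_smul_measure (ae_restrict_of_ae h) _
  exact ae_of_ae_map (measurable_fromUnitTorusN L).aemeasurable h1

/-! ## A.e.-equal profiles have identical fixed-volume objects -/

/-- **The potential part of the maximal form sees only the a.e.-class of `x ↦ v(|x|)`.** [cite: ReedSimonIV1978, §XIII.12] -/
theorem maxFormPot_congr_ae (hL : 0 < L) {v w : ℝ → ℝ≥0∞} (h : ∀ᵐ x : Space, v ‖x‖ = w ‖x‖)
    (η : Lp ℂ 2 (volume : Measure (UnitAddTorus (Fin N × Fin 3)))) : maxFormPot v L η = maxFormPot w L η := by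
  unfold maxFormPot
  refine lintegral_congr_ae ?_
  filter_upwards [ae_comp_fromUnitTorusN_of_ae hL (periodicInteraction_congr_ae (N := N) h L)] with t ht
  rw [ht]

/-- **The maximal form sees only the a.e.-class of the profile** (its kinetic part does not involve `v`).
[cite: ReedSimonIV1978, §XIII.12] -/
theorem maxForm_congr_ae (hL : 0 < L) {v w : ℝ → ℝ≥0∞} (h : ∀ᵐ x : Space, v ‖x‖ = w ‖x‖)
    (η : Lp ℂ 2 (volume : Measure (UnitAddTorus (Fin N × Fin 3)))) : maxForm v L η = maxForm w L η := by
  rw [maxForm_def, maxForm_def, maxFormPot_congr_ae hL h]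

/-- **The maximal-form ground-state class sees only the a.e.-class of the profile** (same form, same `E₀^per`).
[cite: ReedSimonIV1978, §XIII.12] -/
theorem maxFormGroundStates_congr_ae (hL : 0 < L) {v w : ℝ → ℝ≥0∞} (h : ∀ᵐ x : Space, v ‖x‖ = w ‖x‖) (N : ℕ) :
    maxFormGroundStates v N L = maxFormGroundStates w N L := by
  ext η
  rw [mem_maxFormGroundStates, mem_maxFormGroundStates, maxForm_congr_ae hL h, periodicGroundStateEnergy_congr_ae h]

/-- **The Ky Fan two-level sees only the a.e.-class of the profile.** [folklore] -/
theorem kyFanTwo_congr_ae {v w : ℝ → ℝ≥0∞} (h : ∀ᵐ x : Space, v ‖x‖ = w ‖x‖) (N : ℕ) (L : ℝ) :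
    kyFanTwo v N L = kyFanTwo w N L := by
  unfold kyFanTwo
  simp_rw [periodicEnergy_congr_ae h]

/-- A.e.-equal profiles have a.e.-equal truncations at every level. [folklore] -/
theorem truncation_congr_ae {v w : ℝ → ℝ≥0∞} (h : ∀ᵐ x : Space, v ‖x‖ = w ‖x‖) (n : ℕ) :
    ∀ᵐ x : Space, min (v ‖x‖) (n : ℝ≥0∞) = min (w ‖x‖) (n : ℝ≥0∞) := by
  filter_upwards [h] with x hx
  rw [hx]

/-- **(β') is invariant under a.e.-modification of the profile**: a Ky Fan gap of the truncations of `w`, uniform in the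
level, dilute, eventually in `N`, is the same statement for any `v` with `v(|x|) = w(|x|)` a.e. [folklore] -/
theorem uniformTruncationKyFanGap_congr_ae {v w : ℝ → ℝ≥0∞} (h : ∀ᵐ x : Space, v ‖x‖ = w ‖x‖)
    (hw : ∃ ρ₁ : ℝ, 0 < ρ₁ ∧ ∀ ρ : ℝ, 0 < ρ → ρ < ρ₁ → ∀ᶠ N : ℕ in atTop,
      ∃ γ : ℝ, 0 < γ ∧ ∃ n₀ : ℕ, ∀ n : ℕ, n₀ ≤ n →
        2 * periodicGroundStateEnergy (fun r => min (w r) (n : ℝ≥0∞)) N (sideLength ρ N) +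
            ENNReal.ofReal γ ≤
          kyFanTwo (fun r => min (w r) (n : ℝ≥0∞)) N (sideLength ρ N)) :
    ∃ ρ₁ : ℝ, 0 < ρ₁ ∧ ∀ ρ : ℝ, 0 < ρ → ρ < ρ₁ → ∀ᶠ N : ℕ in atTop,
      ∃ γ : ℝ, 0 < γ ∧ ∃ n₀ : ℕ, ∀ n : ℕ, n₀ ≤ n →
        2 * periodicGroundStateEnergy (fun r => min (v r) (n : ℝ≥0∞)) N (sideLength ρ N) +
            ENNReal.ofReal γ ≤
          kyFanTwo (fun r => min (v r) (n : ℝ≥0∞)) N (sideLength ρ N) := by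
  obtain ⟨ρ₁, hρ₁, hw⟩ := hw
  refine ⟨ρ₁, hρ₁, fun ρ hρ hρlt => ?_⟩
  filter_upwards [hw ρ hρ hρlt] with N hN
  obtain ⟨γ, hγ, n₀, hn⟩ := hN
  refine ⟨γ, hγ, n₀, fun n hn' => ?_⟩
  rw [periodicGroundStateEnergy_congr_ae (v := fun r => min (v r) (n : ℝ≥0∞)) (w := fun r => min (w r) (n : ℝ≥0∞))
      (truncation_congr_ae h n),
    kyFanTwo_congr_ae (v := fun r => min (v r) (n : ℝ≥0∞)) (w := fun r => min (w r) (n : ℝ≥0∞))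
      (truncation_congr_ae h n)]
  exact hn n hn'

/-- **Dilute eventual simplicity is invariant under a.e.-modification of the profile** (same ground-state class, same
`E₀^per`, at every `(N, L_N)` with `L_N > 0`). [cite: ReedSimonIV1978, §XIII.12] -/
theorem diluteMaxFormSimple_congr_ae {v w : ℝ → ℝ≥0∞} (h : ∀ᵐ x : Space, v ‖x‖ = w ‖x‖)
    (hw : ∃ ρ₁ : ℝ, 0 < ρ₁ ∧ ∀ ρ : ℝ, 0 < ρ → ρ < ρ₁ → ∀ᶠ N : ℕ in atTop,
        periodicGroundStateEnergy w N (sideLength ρ N) ≠ ⊤ →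
        ∀ η θ : Lp ℂ 2 (volume : Measure (UnitAddTorus (Fin N × Fin 3))),
          η ∈ maxFormGroundStates w N (sideLength ρ N) → θ ∈ maxFormGroundStates w N (sideLength ρ N) →
          η ≠ 0 → θ ≠ 0 → ⟪η, θ⟫_ℂ ≠ 0) :
    ∃ ρ₁ : ℝ, 0 < ρ₁ ∧ ∀ ρ : ℝ, 0 < ρ → ρ < ρ₁ → ∀ᶠ N : ℕ in atTop,
        periodicGroundStateEnergy v N (sideLength ρ N) ≠ ⊤ →
        ∀ η θ : Lp ℂ 2 (volume : Measure (UnitAddTorus (Fin N × Fin 3))),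
          η ∈ maxFormGroundStates v N (sideLength ρ N) → θ ∈ maxFormGroundStates v N (sideLength ρ N) →
          η ≠ 0 → θ ≠ 0 → ⟪η, θ⟫_ℂ ≠ 0 := by
  obtain ⟨ρ₁, hρ₁, hw⟩ := hw
  refine ⟨ρ₁, hρ₁, fun ρ hρ hρlt => ?_⟩
  filter_upwards [hw ρ hρ hρlt, (tendsto_sideLength_atTop hρ).eventually_gt_atTop 0] with N hN hL hE η θ hη hθ
  rw [maxFormGroundStates_congr_ae hL h N] at hη hθ
  rw [periodicGroundStateEnergy_congr_ae h] at hE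
  exact hN hE η θ hη hθ

/-! ## The essential exotic residue X_ess, and X ⇒ X_ess -/

/-- **X ⇒ X_ess**: the registered exotic residue (`stub_diluteMaxFormSimple_exotic`: dilute simplicity for every
admissible `v` that is unbounded, non-integrable, not locally bounded on `(0,∞)` and not of the hard-core class) implies
its essential form (the same conclusion asked only when NO admissible a.e.-modification of `v` is bounded, locally
bounded or hard-core) — take the modification `w := v`. [folklore] -/
theorem essExotic_of_exotic
    (hX : ∀ v : ℝ → ℝ≥0∞, IsRepulsiveFiniteRange v → (¬ ∃ C : ℝ≥0, ∀ r : ℝ, 0 ≤ r → v r ≤ C) →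
      (∫⁻ x : Space, v ‖x‖) = ⊤ →
      (¬ ∀ δ : ℝ, 0 < δ → ∃ M : ℝ≥0∞, M ≠ ⊤ ∧ ∀ r : ℝ, δ < r → v r ≤ M) →
      (¬ ∃ a : ℝ, 0 < a ∧ (∀ r : ℝ, 0 ≤ r → r < a → v r = ⊤) ∧
          ∀ a' : ℝ, a < a' → ∃ M : ℝ≥0∞, M ≠ ⊤ ∧ ∀ r : ℝ, a' < r → v r ≤ M) →
      ∃ ρ₁ : ℝ, 0 < ρ₁ ∧ ∀ ρ : ℝ, 0 < ρ → ρ < ρ₁ → ∀ᶠ N : ℕ in atTop,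
        periodicGroundStateEnergy v N (sideLength ρ N) ≠ ⊤ →
        ∀ η θ : Lp ℂ 2 (volume : Measure (UnitAddTorus (Fin N × Fin 3))),
          η ∈ maxFormGroundStates v N (sideLength ρ N) → θ ∈ maxFormGroundStates v N (sideLength ρ N) →
          η ≠ 0 → θ ≠ 0 → ⟪η, θ⟫_ℂ ≠ 0) :
    ∀ v : ℝ → ℝ≥0∞, IsRepulsiveFiniteRange v → (∫⁻ x : Space, v ‖x‖) = ⊤ →
      (∀ w : ℝ → ℝ≥0∞, IsRepulsiveFiniteRange w → (∀ᵐ x : Space, v ‖x‖ = w ‖x‖) →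
        (¬ ∃ C : ℝ≥0, ∀ r : ℝ, 0 ≤ r → w r ≤ C) ∧
        (¬ ∀ δ : ℝ, 0 < δ → ∃ M : ℝ≥0∞, M ≠ ⊤ ∧ ∀ r : ℝ, δ < r → w r ≤ M) ∧
        (¬ ∃ a : ℝ, 0 < a ∧ (∀ r : ℝ, 0 ≤ r → r < a → w r = ⊤) ∧
          ∀ a' : ℝ, a < a' → ∃ M : ℝ≥0∞, M ≠ ⊤ ∧ ∀ r : ℝ, a' < r → w r ≤ M)) →
      ∃ ρ₁ : ℝ, 0 < ρ₁ ∧ ∀ ρ : ℝ, 0 < ρ → ρ < ρ₁ → ∀ᶠ N : ℕ in atTop,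
        periodicGroundStateEnergy v N (sideLength ρ N) ≠ ⊤ →
        ∀ η θ : Lp ℂ 2 (volume : Measure (UnitAddTorus (Fin N × Fin 3))),
          η ∈ maxFormGroundStates v N (sideLength ρ N) → θ ∈ maxFormGroundStates v N (sideLength ρ N) →
          η ≠ 0 → θ ≠ 0 → ⟪η, θ⟫_ℂ ≠ 0 := by
  intro v hv hint hess
  obtain ⟨hb, hlb, hHC⟩ := hess v hv (Eventually.of_forall fun _ => rfl)
  exact hX v hv hb hint hlb hHC

/-- **G, X_ess ⇒ (β') for EVERY admissible non-integrable potential.** If some admissible a.e.-modification `w` of `v`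
is bounded, locally bounded on `(0,∞)` or of the hard-core class, the gap of `w` (unconditional / unconditional /
modulo G, `…ResidueSimplicity.lean`) is transported to `v` (`uniformTruncationKyFanGap_congr_ae`); otherwise X_ess gives
dilute simplicity of `v` itself and the landed pair-compactness P4 gives the gap. [cite: ReedSimonIV1978, Thm XIII.44] -/
theorem uniformTruncationKyFanGap_of_lemmaG_of_essExotic :
    (∀ b : ℝ, 0 < b → ∃ ρ₁ : ℝ, 0 < ρ₁ ∧ ∀ ρ : ℝ, 0 < ρ → ρ < ρ₁ → ∀ᶠ N : ℕ in atTop,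
      ∀ X ∈ {X : Config N | ∀ i j : Fin N, i ≠ j → ∀ n : Fin 3 → ℤ, b < ‖X i - X j - latticeVec (sideLength ρ N) n‖},
        ∀ Y ∈ {X : Config N | ∀ i j : Fin N, i ≠ j → ∀ n : Fin 3 → ℤ, b < ‖X i - X j - latticeVec (sideLength ρ N) n‖},
          ∃ σ : Equiv.Perm (Fin N),
            JoinedIn {X : Config N | ∀ i j : Fin N, i ≠ j → ∀ n : Fin 3 → ℤ,
              b < ‖X i - X j - latticeVec (sideLength ρ N) n‖} X (Y ∘ σ)) →
    (∀ v : ℝ → ℝ≥0∞, IsRepulsiveFiniteRange v → (∫⁻ x : Space, v ‖x‖) = ⊤ →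
      (∀ w : ℝ → ℝ≥0∞, IsRepulsiveFiniteRange w → (∀ᵐ x : Space, v ‖x‖ = w ‖x‖) →
        (¬ ∃ C : ℝ≥0, ∀ r : ℝ, 0 ≤ r → w r ≤ C) ∧
        (¬ ∀ δ : ℝ, 0 < δ → ∃ M : ℝ≥0∞, M ≠ ⊤ ∧ ∀ r : ℝ, δ < r → w r ≤ M) ∧
        (¬ ∃ a : ℝ, 0 < a ∧ (∀ r : ℝ, 0 ≤ r → r < a → w r = ⊤) ∧
          ∀ a' : ℝ, a < a' → ∃ M : ℝ≥0∞, M ≠ ⊤ ∧ ∀ r : ℝ, a' < r → w r ≤ M)) →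
      ∃ ρ₁ : ℝ, 0 < ρ₁ ∧ ∀ ρ : ℝ, 0 < ρ → ρ < ρ₁ → ∀ᶠ N : ℕ in atTop,
        periodicGroundStateEnergy v N (sideLength ρ N) ≠ ⊤ →
        ∀ η θ : Lp ℂ 2 (volume : Measure (UnitAddTorus (Fin N × Fin 3))),
          η ∈ maxFormGroundStates v N (sideLength ρ N) → θ ∈ maxFormGroundStates v N (sideLength ρ N) →
          η ≠ 0 → θ ≠ 0 → ⟪η, θ⟫_ℂ ≠ 0) →
    ∀ v : ℝ → ℝ≥0∞, IsRepulsiveFiniteRange v → (∫⁻ x : Space, v ‖x‖) = ⊤ →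
    ∃ ρ₁ : ℝ, 0 < ρ₁ ∧ ∀ ρ : ℝ, 0 < ρ → ρ < ρ₁ → ∀ᶠ N : ℕ in atTop,
      ∃ γ : ℝ, 0 < γ ∧ ∃ n₀ : ℕ, ∀ n : ℕ, n₀ ≤ n →
        2 * periodicGroundStateEnergy (fun r => min (v r) (n : ℝ≥0∞)) N (sideLength ρ N) +
            ENNReal.ofReal γ ≤
          kyFanTwo (fun r => min (v r) (n : ℝ≥0∞)) N (sideLength ρ N) := by
  intro hG hXe v hv hint
  by_cases hmod : ∃ w : ℝ → ℝ≥0∞, IsRepulsiveFiniteRange w ∧ (∀ᵐ x : Space, v ‖x‖ = w ‖x‖) ∧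
      ((∃ C : ℝ≥0, ∀ r : ℝ, 0 ≤ r → w r ≤ C) ∨
       (∀ δ : ℝ, 0 < δ → ∃ M : ℝ≥0∞, M ≠ ⊤ ∧ ∀ r : ℝ, δ < r → w r ≤ M) ∨
       (∃ a : ℝ, 0 < a ∧ (∀ r : ℝ, 0 ≤ r → r < a → w r = ⊤) ∧
          ∀ a' : ℝ, a < a' → ∃ M : ℝ≥0∞, M ≠ ⊤ ∧ ∀ r : ℝ, a' < r → w r ≤ M))
  · obtain ⟨w, hw, hvw, hclass⟩ := hmod
    refine uniformTruncationKyFanGap_congr_ae hvw ?_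
    rcases hclass with hb | hlb | hHC
    · exact ⟨1, one_pos, fun ρ hρ _ => uniformTruncationKyFanGap_of_bounded w hw hb ρ hρ⟩
    · exact uniformTruncationKyFanGap_of_locallyBounded w hw hlb
    · exact hardCore_uniformTruncationKyFanGap_of_lemmaG hG w hw hHC
  · refine uniformTruncationKyFanGap_of_diluteSimple v hv (hXe v hv hint fun w hw hvw => ?_)
    have h3 := not_or.1 fun hor => hmod ⟨w, hw, hvw, hor⟩
    exact ⟨h3.1, (not_or.1 h3.2).1, (not_or.1 h3.2).2⟩

end Summit.AtomisticToContinuum.BoseEinsteinCondensation.Cruxes.HardCoreExtension.ThirdLawCurrentFloorAlt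

end
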